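import Mathlib
import HarnessLib
import Literature.Analysis.FluidPDE.RadialCalculus
import Summits.NavierStokesRegularity.NavierStokesRegularity.Theorems.UnthreadedDoorAntidynamoLocalLaplacianProduct
import Summits.NavierStokesRegularity.NavierStokesRegularity.Theorems.UnthreadedDoorAntidynamoToroidalFieldHarmonic
import Summits.NavierStokesRegularity.NavierStokesRegularity.Theorems.UnthreadedDoorAntidynamoRadialGradientUnthreaded

/-!
# Route `UnthreadedDoor` / `ThreadingFlux`, crux `PoloidalLiouville` (stmt-NavierStokesRegularity-1222), antidynamo v2 skeleton
# (sha16 `4ebf5683127b`), rung `stub_singleDegreeRung` (BC5): STEP S4 — THE LAPLACIAN OF A SINGLE-DEGREE TOROIDAL VORTICITY,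
# `Δ(H(‖y‖) Λ(y)) = (H″ + (2l+2) H′/r) Λ` off the origin

Support file (seat leafhand-ns-unthreadeddoor-1 g0, cell decomp-ns), `--supports stmt-NavierStokesRegularity-1222 --as helper`; theorems only.
With `Λ = ∇Q × id` for a harmonic, positively homogeneous (degree `l`) profile `Q ∈ C³` and a radial factor `H ∈ C²(0,∞)`:
the radial Laplacian `Δ(H ∘ ‖·‖) = H″ + 2H′/r` and gradient `∇(H ∘ ‖·‖) = (H′/r) • id` (tree `laplacian_comp_norm_sq`,
`hasFDerivAt_comp_norm_sq` in the variable `σ = r²`), the local product rule (p797439), `ΔΛ = 0` and the Euler identity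
`DΛ(y)[y] = lΛ(y)` (p797516) give the displayed formula — the linear (heat) part of the single-degree vorticity dynamics, i.e. the radial
heat operator of dimension `2l + 3`.

* `hasDerivAt_comp_sqrt` bookkeeping, `laplacian_radial`, `gradient_radial` — radial calculus in the variable `r` (not `r²`).
* ★★ `laplacian_radial_smul_cross_gradient` — the displayed S4 formula.

HONEST LABEL: calculus (step S4); the dynamics S5 remains; nothing here bears on `PoloidalLiouville` (1222) or NS regularity. [folklore]
-/

noncomputable section

-- the summit and its single sub-problem share the name (CONVENTIONS §1)
set_option linter.dupNamespace false

open scoped Topology InnerProductSpace RealInnerProductSpace ContDiff Laplacian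
open Filter Set Function Metric
open Literature.Analysis.FluidPDE

namespace Summit.NavierStokesRegularity.NavierStokesRegularity.Theorems.PoloidalLiouville.Antidynamo

/-- RADIAL CALCULUS in the variable `r`: for `H ∈ C²(0,∞)` and `y ≠ 0`, `Δ(H ∘ ‖·‖)(y) = H″(‖y‖) + 2 H′(‖y‖)/‖y‖` and
`∇(H ∘ ‖·‖)(y) = (H′(‖y‖)/‖y‖) • y` (from the tree's `σ = r²` formulas with `g = H ∘ √·`). [folklore] -/
theorem laplacian_and_gradient_radial {H : ℝ → ℝ} (hH : ContDiffOn ℝ 2 H (Ioi 0)) {y : EuclideanSpace ℝ (Fin 3)} (hy : y ≠ 0) :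
    (Δ fun w : EuclideanSpace ℝ (Fin 3) => H ‖w‖) y = deriv (deriv H) ‖y‖ + 2 * deriv H ‖y‖ / ‖y‖ ∧
    gradient (fun w : EuclideanSpace ℝ (Fin 3) => H ‖w‖) y = (deriv H ‖y‖ / ‖y‖) • y := by
  have hr : 0 < ‖y‖ := norm_pos_iff.2 hy
  -- derivatives of `H` and `H′` on `(0, ∞)`
  have hHd : ∀ ρ : ℝ, 0 < ρ → HasDerivAt H (deriv H ρ) ρ := fun ρ hρ =>
    ((hH.differentiableOn (by norm_num)).differentiableAt (Ioi_mem_nhds hρ)).hasDerivAt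
  have hH1 : ContDiffOn ℝ 1 (deriv H) (Ioi 0) := hH.deriv_of_isOpen isOpen_Ioi (by norm_num)
  have hH1d : ∀ ρ : ℝ, 0 < ρ → HasDerivAt (deriv H) (deriv (deriv H) ρ) ρ := fun ρ hρ =>
    ((hH1.differentiableOn one_ne_zero).differentiableAt (Ioi_mem_nhds hρ)).hasDerivAt
  -- the profile in `σ = r²`: `g = H ∘ √`, `g₁ σ = H′(√σ) / (2√σ)`
  set g : ℝ → ℝ := fun σ => H (Real.sqrt σ) with hg
  set g₁ : ℝ → ℝ := fun σ => deriv H (Real.sqrt σ) * (1 / (2 * Real.sqrt σ)) with hg₁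
  have hgd : ∀ σ ∈ Ioi (0 : ℝ), HasDerivAt g (g₁ σ) σ := by
    intro σ hσ
    have hs : HasDerivAt Real.sqrt (1 / (2 * Real.sqrt σ)) σ := Real.hasDerivAt_sqrt (ne_of_gt hσ)
    exact (hHd _ (Real.sqrt_pos.2 hσ)).comp σ hs
  have hσ : ‖y‖ ^ 2 ∈ Ioi (0 : ℝ) := mem_Ioi.2 (by positivity)
  have hsq : Real.sqrt (‖y‖ ^ 2) = ‖y‖ := Real.sqrt_sq (norm_nonneg y)
  -- derivative of `g₁` at `σ₀ = ‖y‖²`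
  have hs0 : HasDerivAt Real.sqrt (1 / (2 * ‖y‖)) (‖y‖ ^ 2) := by
    have := Real.hasDerivAt_sqrt (ne_of_gt hσ)
    rwa [hsq] at this
  have hA : HasDerivAt (fun σ => deriv H (Real.sqrt σ)) (deriv (deriv H) ‖y‖ * (1 / (2 * ‖y‖))) (‖y‖ ^ 2) := by
    have := (hH1d ‖y‖ hr)
    rw [← hsq] at this
    have h := this.comp (‖y‖ ^ 2) hs0
    rw [hsq] at h
    exact h
  have hB : HasDerivAt (fun σ => 1 / (2 * Real.sqrt σ)) (-(2 * (1 / (2 * ‖y‖))) / (2 * ‖y‖) ^ 2) (‖y‖ ^ 2) := by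
    have h2 : HasDerivAt (fun σ => 2 * Real.sqrt σ) (2 * (1 / (2 * ‖y‖))) (‖y‖ ^ 2) := hs0.const_mul 2
    have hne : 2 * Real.sqrt (‖y‖ ^ 2) ≠ 0 := by rw [hsq]; positivity
    have h3 := h2.inv hne
    rw [hsq] at h3
    refine h3.congr_of_eventuallyEq (Filter.Eventually.of_forall fun σ => ?_)
    simp only [one_div, Pi.inv_apply]
  have hg₁d : HasDerivAt g₁ (deriv (deriv H) ‖y‖ * (1 / (2 * ‖y‖)) * (1 / (2 * ‖y‖)) +
      deriv H ‖y‖ * (-(2 * (1 / (2 * ‖y‖))) / (2 * ‖y‖) ^ 2)) (‖y‖ ^ 2) := by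
    have := hA.mul hB
    simp only [hsq] at this
    exact this
  refine ⟨?_, ?_⟩
  · have hΔ := laplacian_comp_norm_sq (E := EuclideanSpace ℝ (Fin 3)) isOpen_Ioi hgd hσ hg₁d
    have hfun : (fun w : EuclideanSpace ℝ (Fin 3) => g (‖w‖ ^ 2)) = fun w => H ‖w‖ := by
      funext w; simp only [hg, Real.sqrt_sq (norm_nonneg w)]
    rw [hfun] at hΔ
    rw [hΔ, finrank_euclideanSpace_fin]
    simp only [hg₁, hsq]
    push_cast
    field_simp
    ring
  · have hG := hasFDerivAt_comp_norm_sq (E := EuclideanSpace ℝ (Fin 3)) (hgd _ hσ)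
    have hfun : (fun w : EuclideanSpace ℝ (Fin 3) => g (‖w‖ ^ 2)) = fun w => H ‖w‖ := by
      funext w; simp only [hg, Real.sqrt_sq (norm_nonneg w)]
    rw [hfun] at hG
    rw [gradient, hG.fderiv, toDual_symm_smul_innerSL]
    congr 1
    simp only [hg₁, hsq]
    field_simp

/-- ★★ STEP S4: for a harmonic, positively homogeneous (degree `l`) profile `Q ∈ C³`, a radial factor `H ∈ C²(0,∞)` and `y ≠ 0`,
`Δ(H(‖·‖) • (∇Q × id))(y) = (H″(‖y‖) + (2l+2) H′(‖y‖)/‖y‖) • (∇Q(y) × y)`. [folklore] -/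
theorem laplacian_radial_smul_cross_gradient {Q : EuclideanSpace ℝ (Fin 3) → ℝ} (hQ : ContDiff ℝ 3 Q) {l : ℕ}
    (hhom : ∀ r : ℝ, 0 < r → ∀ y : EuclideanSpace ℝ (Fin 3), Q (r • y) = r ^ l * Q y) (hharm : ∀ y, (Δ Q) y = 0)
    {H : ℝ → ℝ} (hH : ContDiffOn ℝ 2 H (Ioi 0)) {y : EuclideanSpace ℝ (Fin 3)} (hy : y ≠ 0) :
    (Δ fun w : EuclideanSpace ℝ (Fin 3) => H ‖w‖ • cross (gradient Q w) w) y =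
      (deriv (deriv H) ‖y‖ + (2 * l + 2) * deriv H ‖y‖ / ‖y‖) • cross (gradient Q y) y := by
  have hr : 0 < ‖y‖ := norm_pos_iff.2 hy
  have hQ2 : ContDiff ℝ 2 Q := hQ.of_le (by norm_cast)
  -- smoothness of the two factors on `{0}ᶜ`
  have hF : ContDiffOn ℝ 2 (fun w : EuclideanSpace ℝ (Fin 3) => H ‖w‖) ({0}ᶜ : Set (EuclideanSpace ℝ (Fin 3))) := by
    intro w hw
    have hw0 : w ≠ 0 := hw
    have h1 : ContDiffAt ℝ 2 (fun w : EuclideanSpace ℝ (Fin 3) => ‖w‖) w := contDiffAt_norm ℝ hw0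
    exact ((hH.contDiffAt (Ioi_mem_nhds (norm_pos_iff.2 hw0))).comp w h1).contDiffWithinAt
  have hΛ : ContDiff ℝ 2 fun w : EuclideanSpace ℝ (Fin 3) => cross (gradient Q w) w := by
    have hgrad : ContDiff ℝ 2 (gradient Q) := by
      have : gradient Q = fun y => (InnerProductSpace.toDual ℝ (EuclideanSpace ℝ (Fin 3))).symm (fderiv ℝ Q y) := rfl
      rw [this]
      exact (InnerProductSpace.toDual ℝ (EuclideanSpace ℝ (Fin 3))).symm.contDiff.comp (hQ.fderiv_right (m := 2) (by norm_cast))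
    have : (fun w : EuclideanSpace ℝ (Fin 3) => cross (gradient Q w) w) = fun w => crossCLM (gradient Q w) w := by
      funext w; rw [crossCLM_apply]
    rw [this]
    exact (crossCLM.contDiff.comp hgrad).clm_apply contDiff_id
  rw [laplacian_smul_field_of_contDiffOn isOpen_compl_singleton hF hΛ.contDiffOn (show y ∈ ({0}ᶜ : Set _) from hy),
    laplacian_cross_gradient_eq_zero hQ hharm y, smul_zero, zero_add]
  obtain ⟨hΔ, hgrad⟩ := laplacian_and_gradient_radial hH hy
  rw [hΔ, hgrad, map_smul, fderiv_cross_gradient_apply_self hQ2 hhom y, smul_smul, smul_smul, ← add_smul]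
  congr 1
  field_simp
  ring

end Summit.NavierStokesRegularity.NavierStokesRegularity.Theorems.PoloidalLiouville.Antidynamo

end
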